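import Mathlib.RingTheory.TensorProduct.Basic
import Mathlib.RepresentationTheory.Induced
import Mathlib.RepresentationTheory.Intertwining
import Mathlib.Analysis.Complex.Circle
import Mathlib.RingTheory.Trace.Basic
import Mathlib.LinearAlgebra.Determinant
import Mathlib.RingTheory.Nilpotent.Lemmas
import Mathlib.MeasureTheory.Group.Measure
import Literature.NumberTheory.Automorphic.TateLocalFactors
import Literature.NumberTheory.GaloisRepresentations.WeilDeligneRep
import Literature.NumberTheory.GaloisRepresentations.WeilGroup
import Literature.NumberTheory.GaloisRepresentations.LocalClassFieldTheory
import Literature.NumberTheory.GaloisRepresentations.LocalField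
import HarnessLib

-- provenance: harness21/H21/H21/Prelude/AutomorphicL/LocalConstants.lean @ 7efdc51 (interim HEAD d8f2665); M5 mechanical rewrite
/-!
# Deligne–Langlands local constants of Weil–Deligne representations
(AutomorphicL trunk, prelude I19; notion `rankin_selberg_local_factors`, part 4; `l_parameter`)

Let `F` be a non-archimedean local field with Weil group `W_F = Literature.WeilGroup F`, residue
cardinality `q`, and let `(ρ, N)` be a Weil–Deligne representation of `W_F` on a
finite-dimensional complex vector space `V` (`Literature.WeilDeligneRep F ℂ V`, GalRep item C8).
Deligne (*Les constantes des équations fonctionnelles des fonctions L*, Antwerp II, LNM 349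
(1973), §4–§8, Thm. 4.1 and Thm. 6.5) and Langlands proved that there is a unique system of
*local constants* `ε₀(ρ, ψ, dx) ∈ ℂˣ`, attached to every finite extension `E/F`, every
continuous non-trivial additive character `ψ` of `E`, every Haar measure `dx` on `E` and every
continuous finite-dimensional complex representation `ρ` of `W_E`, which

* is multiplicative in short exact sequences,
* agrees in dimension one, via local class field theory, with Tate's local constant
  `ε(0, χ, ψ)` = the `e` of `ε(s, χ, ψ) = e · q^{-a s}` (`Literature.NumberTheory.Automorphic.HasTateEpsilon`),
* scales as `ε₀(ρ, ψ, c dx) = c ^ dim ρ · ε₀(ρ, ψ, dx)` and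
  `ε₀(ρ, ψ(b ·), dx) = det ρ(b) ‖b‖^{-dim ρ} ε₀(ρ, ψ, dx)`, and
* is *inductive in degree zero* for finite separable extensions `E'/E`
(Tate, *Number theoretic background*, Corvallis 1979, §3.4; Bushnell–Henniart, *The local
Langlands conjecture for GL(2)* (2006), §29–§31).  For a Weil–Deligne representation one puts
(Deligne 1973, §8.12; Tate 1979, (4.1.6))
`ε((ρ, N), s, ψ, dx) = ε₀(ρ ⊗ ω_s, ψ, dx) · det(-Φ q^{-s} | V^{I_F} / (ker N)^{I_F})`,
`Φ` a geometric Frobenius.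

## Contents

Dot-notation extensions of G09's `Literature.NumberTheory.GaloisRepresentations.WeilDeligneRep` (declared in the namespace
`Literature.NumberTheory.GaloisRepresentations.WeilDeligneRep`, which is H21's own):

* `WeilDeligneRep.tprod r r'` — tensor product `(ρ ⊗ ρ', N ⊗ 1 + 1 ⊗ N')` (Mathlib
  `Representation.tprod`, `TensorProduct.map`, `Commute.isNilpotent_add`); `tprod_ρ_apply`.
* `WeilDeligneRep.ofSubrep r p h`, `WeilDeligneRep.toQuotient r p h` — sub- and quotient
  representations on an invariant subspace `p` (Mathlib `Representation.subrepresentation`,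
  `Representation.quotient`, `Submodule.mapQ`, `Module.End.isNilpotent.restrict`).
* `WeilDeligneRep.unramifiedTwist r s = (ρ ⊗ ‖·‖^s, N)` (`WeilGroup.norm`, `Complex.cpow`).
* `WeilDeligneRep.ofQuasiChar d χ` — the one-dimensional Weil–Deligne representation
  `(χ ∘ artin, 0)` attached to a quasi-character `χ : Fˣ →ₜ* ℂˣ` through a local Artin datum
  `d` (G09 `LocalArtinData.recGL1`).
* `WeilDeligneRep.inertiaInvariants r = V^{I_F}` (Mathlib `Representation.invariants`),
  `WeilDeligneRep.inertiaQuotEnd r w` (the action of `w` on `V^{I_F} ⧸ (ker N)^{I_F}`, via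
  Mathlib `Representation.toInvariants` and `Submodule.mapQ`) and
  `WeilDeligneRep.frobDetFactor r s = det(-q^{-s} Φ | V^I ⧸ (ker N)^I)` for the chosen geometric
  Frobenius `Φ = WeilDeligneRep.geomFrob F` of G09 (independence: `frobDetFactor_eq`).
* `WeilDeligneRep.IsInducedFrom h r r'` — `ρ ≅ Ind_{W_{E'}}^{W_E} ρ'` (Mathlib
  `Representation.ind`, `Representation.Equiv`), the inclusion `res(W_{E'}) ≤ W_E` being the
  explicit hypothesis `h` (as in G09 `WeilGroup.map`).
* `Literature.Automorphic.LocalEpsilonSystem F` — Deligne's system `ε₀` as a *hypothesis structure*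
  (nothing constructed, nothing sorried inside), `epsilonWD hmul huniq hn hex 𝓔 ψ μ r s`, and
  the named facts (`def … : Prop`, D-0014) `nonempty_localEpsilonSystem`,
  `localEpsilonSystem_unique` (Deligne 1973, Thm. 4.1, 6.5), `epsilonWD_tprod_unramified`
  (Tate 1979, (3.4.5), (4.1.6)).

## Mathlib search

Mathlib (this pin) has `Representation.tprod`, `Representation.subrepresentation`,
`Representation.quotient`, `Representation.ind`/`IndV`, `Representation.Equiv`,
`Representation.invariants`, `Representation.le_comap_invariants`,
`Representation.toInvariants` (the `G`-representation on `V^S` for `S` normal),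
`TensorProduct.map`, `Commute.isNilpotent_add`,
`Module.End.isNilpotent.restrict`, `Submodule.mapQ_pow`, `LinearMap.det`, `AddChar.mulShift`,
`AddChar.compAddMonoidHom`, `Algebra.trace`, `DistribMulAction.toModuleEnd`, all used below; it
has no local constants / root numbers (`rg -i 'epsilon factor|root number|local constant'` finds
nothing relevant) and no Weil–Deligne representations.

## Design choices

* **Frobenius convention.** As in G09 `WeilDeligneRep.eulerFactor`, the determinant factor uses a
  *geometric* Frobenius `Φ`, `WeilGroup.deg Φ = -1` (`‖Φ‖ = q⁻¹`; sign convention of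
  `Literature.Prelude.GalRep.WeilGroup`), following Tate 1979, (4.1.6) and Deligne 1973, §8.12.  The
  outline lets the worker choose between a predicate and a function; we follow G09
  `eulerFactor` and define the *function* `frobDetFactor r s` with G09's chosen
  `WeilDeligneRep.geomFrob F hex`, the independence of the choice (two geometric Frobenii differ
  by inertia, which acts trivially on `V^{I_F}`) being the named fact `frobDetFactor_eq`; this
  makes `epsilonWD hmul huniq hn hex 𝓔 ψ μ r s` a function, as consumed downstream (I20).
* **Local class field theory enters as data.** The dimension-one normalisation and the
  `ψ ↦ ψ(b ·)` rule refer to the reciprocity map of *each* finite extension `E/F`; since G09's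
  `LocalArtinData E` is a hypothesis structure whose axioms do not single out the canonical
  Artin map, a `LocalEpsilonSystem F` carries the family `artin E : LocalArtinData E` it is
  normalised against as a field (data, no axioms beyond those of `LocalArtinData`).  Deligne's
  existence theorem provides a system for the canonical Artin maps
  (`nonempty_localEpsilonSystem`); uniqueness is stated for two systems with the same Artin
  data (`localEpsilonSystem_unique`), which is exactly Deligne 1973, Thm. 4.1.
* **Universe discipline (outline H9).** `ε₀` quantifies over `E V : Type`; accordingly the base
  field of a `LocalEpsilonSystem` lives in `Type`.
* Every axiom of `LocalEpsilonSystem` assumes `ψ.IsContinuousNontrivial` and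
  `[μ.IsAddHaarMeasure]`; off these hypotheses `ε₀` is unconstrained (no junk values are pinned).
* `ofQuasiChar` needs "a continuous character `W_F →ₜ* ℂˣ` is trivial on an open subgroup of
  `I_F`" (`I_F` profinite, `ℂˣ` has no small subgroups); this is the named fact
  `WeilGroup.exists_subgroup_le_inertia_isOpen_of_continuous`, threaded as the explicit
  hypothesis `hns` of `ofQuasiChar` (and hence of the axiom `LocalEpsilonSystem.dim_one` and of
  `epsilonWD_tprod_unramified`).
* `induction_degree_zero` is imposed only for *separable* `E'/E` with `[ValuativeExtension E E']`
  (Deligne 1973, §4.1 works in a separable closure; for inseparable `E'/E` the trace vanishes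
  and the axiom would make `LocalEpsilonSystem F` empty in characteristic `p`).
* D-0014 (Literature carries no unproved proof terms): the unproved results `frobDetFactor_eq`,
  `WeilGroup.exists_subgroup_le_inertia_isOpen_of_continuous`, `nonempty_localEpsilonSystem`,
  `localEpsilonSystem_unique`, `epsilonWD_tprod_unramified` are named facts
  `def <name> : Prop := <statement>`; the `LocalGaloisGroup` named facts are threaded as explicit
  hypotheses following G09 `WeilGroup`/`WeilDeligneRep`: `hmul huniq` (`IsFrobPow.mul/unique`)
  into `WeilGroup.normCpow`, `unramifiedTwist`, `epsilonWD`; `hn : absInertia_normal F` into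
  `ρ_apply_mem_inertiaInvariants`, `inertiaQuotEnd`, `frobDetFactor`, `epsilonWD`;
  `hex : exists_isFrobPow` into `frobDetFactor`, `epsilonWD`.

## Downstream note (M5 migration)

Signature changes importers must absorb: `epsilonWD 𝓔 ψ μ r s` ↦
`epsilonWD hmul huniq hn hex 𝓔 ψ μ r s`; `r.unramifiedTwist s` ↦ `r.unramifiedTwist hmul huniq s`;
`r.frobDetFactor s` ↦ `r.frobDetFactor hn hex s`; `r.inertiaQuotEnd w` ↦ `r.inertiaQuotEnd hn w`;
`WeilDeligneRep.ofQuasiChar d χ` ↦ `WeilDeligneRep.ofQuasiChar hns d χ`;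
`nonempty_localEpsilonSystem F` is now a `Prop` (thread it where inhabitedness is used).  Known
code site: `Literature/NumberTheory/Automorphic/LocalLanglandsGL.lean` (`epsilonWD` inside the
`IsLocalLanglandsGL` structure).
-/

noncomputable section

open scoped NNReal TensorProduct
open Module MeasureTheory

namespace Literature.NumberTheory.Automorphic

variable {F : Type*} [Field F] [ValuativeRel F] [TopologicalSpace F] [IsNonarchimedeanLocalField F]

open GaloisRepresentations.IsNonarchimedeanLocalField GaloisRepresentations.WeilGroup

section WeilDeligneRep
open Literature.NumberTheory.GaloisRepresentations (WeilDeligneRep)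
open Literature.NumberTheory.GaloisRepresentations.WeilDeligneRep

/-! ### Tensor products, subrepresentations, quotients -/

section General

variable {C : Type*} [Field C] [CharZero C] {V : Type*} [AddCommGroup V] [Module C V]
  {V' : Type*} [AddCommGroup V'] [Module C V']

/-- The **tensor product** of two Weil–Deligne representations:
`(ρ ⊗ ρ', N ⊗ 1 + 1 ⊗ N')` on `V ⊗[C] V'` (Mathlib `Representation.tprod`, `TensorProduct.map`).
The monodromy is nilpotent as a sum of two commuting nilpotents (`Commute.isNilpotent_add`).
Ref: Deligne, Antwerp II, LNM 349 (1973), §8.4.1, (8.1.2); Tate, Corvallis 1979, (4.1.5). [cite: Corvallis1979, (4.1.5] -/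
def _root_.Literature.NumberTheory.GaloisRepresentations.WeilDeligneRep.tprod (r : WeilDeligneRep F C V) (r' : WeilDeligneRep F C V') :
    WeilDeligneRep F C (V ⊗[C] V') where
  ρ := r.ρ.tprod r'.ρ
  isContinuous := by
    obtain ⟨U, hU, hUo, hρ⟩ := r.isContinuous
    obtain ⟨U', -, hUo', hρ'⟩ := r'.isContinuous
    refine ⟨U ⊓ U', inf_le_left.trans hU, hUo.inter hUo', fun u hu => ?_⟩
    rw [Representation.tprod_apply, hρ u hu.1, hρ' u hu.2, TensorProduct.map_one]
  N := TensorProduct.map r.N 1 + TensorProduct.map 1 r'.N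
  isNilpotent_N := by
    refine Commute.isNilpotent_add ?_ ?_ ?_
    · change _ * _ = _ * _
      rw [← TensorProduct.map_mul, ← TensorProduct.map_mul, mul_one, one_mul, mul_one, one_mul]
    · obtain ⟨k, hk⟩ := r.isNilpotent_N
      exact ⟨k, by rw [TensorProduct.map_pow, hk, one_pow, TensorProduct.map_zero_left]⟩
    · obtain ⟨k, hk⟩ := r'.isNilpotent_N
      exact ⟨k, by rw [TensorProduct.map_pow, hk, one_pow, TensorProduct.map_zero_right]⟩
  conj_N w := by
    ext v v'
    simp [TensorProduct.map_tmul, r.ρ_N_apply, r'.ρ_N_apply, TensorProduct.smul_tmul,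
      TensorProduct.tmul_smul, smul_add]

/-- The representation underlying `r.tprod r'` at `w` is `ρ(w) ⊗ ρ'(w)`.
Ref: Deligne, Antwerp II (1973), §8.4.1. [cite: II1973] -/
@[simp] theorem _root_.Literature.NumberTheory.GaloisRepresentations.WeilDeligneRep.tprod_ρ_apply (r : WeilDeligneRep F C V) (r' : WeilDeligneRep F C V')
    (w : GaloisRepresentations.WeilGroup F) : (r.tprod r').ρ w = TensorProduct.map (r.ρ w) (r'.ρ w) := rfl

/-- The monodromy of `r.tprod r'` is `N ⊗ 1 + 1 ⊗ N'`.
Ref: Deligne, Antwerp II (1973), (8.1.2). [cite: II1973] -/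
@[simp] theorem _root_.Literature.NumberTheory.GaloisRepresentations.WeilDeligneRep.tprod_N (r : WeilDeligneRep F C V) (r' : WeilDeligneRep F C V') :
    (r.tprod r').N = TensorProduct.map r.N 1 + TensorProduct.map 1 r'.N := rfl

/-- The **sub-Weil–Deligne representation** on a subspace `p ≤ V` stable under `ρ(W_F)` and `N`
(`r.IsSubrep p`): `(ρ|_p, N|_p)` (Mathlib `Representation.subrepresentation`,
`LinearMap.restrict`).  Ref: Deligne, Antwerp II (1973), §8.4.1; Tate, Corvallis 1979, (4.1.5). [cite: II1973] -/
def _root_.Literature.NumberTheory.GaloisRepresentations.WeilDeligneRep.ofSubrep (r : WeilDeligneRep F C V) (p : Submodule C V) (h : r.IsSubrep p) :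
    WeilDeligneRep F C p where
  ρ := r.ρ.subrepresentation p h.1
  isContinuous := by
    obtain ⟨U, hU, hUo, hρ⟩ := r.isContinuous
    refine ⟨U, hU, hUo, fun u hu => ?_⟩
    ext v
    simp [hρ u hu]
  N := r.N.restrict fun _ hv => h.2 hv
  isNilpotent_N := Module.End.isNilpotent.restrict _ r.isNilpotent_N
  conj_N w := by
    ext v
    simp [LinearMap.restrict_apply, r.ρ_N_apply]

/-- The **quotient Weil–Deligne representation** on `V ⧸ p` for a subspace `p ≤ V` stable under
`ρ(W_F)` and `N`: `(ρ mod p, N mod p)` (Mathlib `Representation.quotient`, `Submodule.mapQ`).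
Ref: Deligne, Antwerp II (1973), §8.4.1; Tate, Corvallis 1979, (4.1.5). [cite: II1973] -/
def _root_.Literature.NumberTheory.GaloisRepresentations.WeilDeligneRep.toQuotient (r : WeilDeligneRep F C V) (p : Submodule C V) (h : r.IsSubrep p) :
    WeilDeligneRep F C (V ⧸ p) where
  ρ := r.ρ.quotient p h.1
  isContinuous := by
    obtain ⟨U, hU, hUo, hρ⟩ := r.isContinuous
    refine ⟨U, hU, hUo, fun u hu => ?_⟩
    ext v
    simp [hρ u hu]
  N := p.mapQ p r.N h.2
  isNilpotent_N := by
    obtain ⟨k, hk⟩ := r.isNilpotent_N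
    exact ⟨k, by rw [← Submodule.mapQ_pow (h := h.2)]; ext v; simp [hk]⟩
  conj_N w := by
    ext v
    simp [r.ρ_N_apply, Submodule.Quotient.mk_smul]

/-! ### Inertia invariants and the Frobenius determinant factor -/

/-- The subspace `V^{I_F}` of inertia invariants (Mathlib `Representation.invariants` of the
restriction of `ρ` to `WeilGroup.inertia F`).  G09's `inertiaInvariantsKerN r = ker N ⊓ V^{I_F}`.
Ref: Tate, Corvallis 1979, (4.1.6); Deligne, Antwerp II (1973), §8.12. [cite: Corvallis1979, (4.1.6] -/
def _root_.Literature.NumberTheory.GaloisRepresentations.WeilDeligneRep.inertiaInvariants (r : WeilDeligneRep F C V) : Submodule C V :=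
  Representation.invariants (r.ρ.comp (inertia F).subtype)

/-- Membership in `V^{I_F}`.  Ref: Tate, Corvallis 1979, (4.1.6). [cite: Corvallis1979, (4.1.6] -/
theorem _root_.Literature.NumberTheory.GaloisRepresentations.WeilDeligneRep.mem_inertiaInvariants_iff (r : WeilDeligneRep F C V) (v : V) :
    v ∈ r.inertiaInvariants ↔ ∀ u ∈ inertia F, r.ρ u v = v := by
  simp only [inertiaInvariants, Representation.mem_invariants, Subtype.forall, MonoidHom.coe_comp,
    Function.comp_apply, Subgroup.subtype_apply]

/-- `(ker N)^{I_F} ≤ V^{I_F}`.  Ref: Tate, Corvallis 1979, (4.1.6). [cite: Corvallis1979, (4.1.6] -/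
theorem _root_.Literature.NumberTheory.GaloisRepresentations.WeilDeligneRep.inertiaInvariantsKerN_le_inertiaInvariants (r : WeilDeligneRep F C V) :
    r.inertiaInvariantsKerN ≤ r.inertiaInvariants :=
  inf_le_right

/-- `V^{I_F}` is stable under every `ρ(w)` (`I_F` is normal in `W_F`, G09 `inertia_normal`); this
is Mathlib `Representation.le_comap_invariants`.  Ref: Tate, Corvallis 1979, (4.1.6). [cite: Corvallis1979, (4.1.6] -/
theorem _root_.Literature.NumberTheory.GaloisRepresentations.WeilDeligneRep.ρ_apply_mem_inertiaInvariants (hn : GaloisRepresentations.absInertia_normal F) (r : WeilDeligneRep F C V)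
    (w : GaloisRepresentations.WeilGroup F) {v : V} (hv : v ∈ r.inertiaInvariants) : r.ρ w v ∈ r.inertiaInvariants :=
  haveI := inertia_normal hn
  Representation.le_comap_invariants r.ρ (inertia F) w hv

/-- `(ker N)^{I_F}` viewed inside `V^{I_F}` (Mathlib `Submodule.comap` along the inclusion).
Ref: Tate, Corvallis 1979, (4.1.6). [cite: Corvallis1979, (4.1.6] -/
def _root_.Literature.NumberTheory.GaloisRepresentations.WeilDeligneRep.kerNInertiaInvariants (r : WeilDeligneRep F C V) : Submodule C r.inertiaInvariants :=
  r.inertiaInvariantsKerN.comap r.inertiaInvariants.subtype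

/-- The action of `w ∈ W_F` on `V^{I_F} ⧸ (ker N)^{I_F}`: the representation
`Representation.toInvariants ρ I_F` of `W_F` on `V^{I_F}` (Mathlib) passed to the quotient by
`Submodule.mapQ`.  For a geometric Frobenius `w = Φ` its twisted determinant is the factor
`det(-Φ q^{-s} | V^I / V_N^I)` (`frobDetFactor`) of Tate, Corvallis 1979, (4.1.6); Deligne,
Antwerp II (1973), §8.12.  Hypothesis `hn : absInertia_normal F` (normality of inertia, D-0014
thread as in G09 `restrictInertiaInvariantsKerN`). [cite: Corvallis1979, (4.1.6] -/
def _root_.Literature.NumberTheory.GaloisRepresentations.WeilDeligneRep.inertiaQuotEnd (hn : GaloisRepresentations.absInertia_normal F) (r : WeilDeligneRep F C V) (w : GaloisRepresentations.WeilGroup F) :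
    Module.End C (r.inertiaInvariants ⧸ r.kerNInertiaInvariants) :=
  haveI := inertia_normal hn
  r.kerNInertiaInvariants.mapQ r.kerNInertiaInvariants (r.ρ.toInvariants (inertia F) w)
    fun _ hv => r.ρ_apply_mem_inertiaInvariantsKerN hn w hv

end General

/-! ### Complex coefficients: unramified twists, characters, the determinant factor -/

section Complex

variable {V : Type*} [AddCommGroup V] [Module ℂ V] {V' : Type*} [AddCommGroup V'] [Module ℂ V']

/-- The unramified quasi-character `ω_s = ‖·‖^s : W_F → ℂ`, `w ↦ (q ^ deg w) ^ s`
(`WeilGroup.norm`, `Complex.cpow` of a positive real), as a monoid homomorphism.  The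
`LocalGaloisGroup` named facts `IsFrobPow.mul` (`hmul`) and `IsFrobPow.unique` (`huniq`), which
make `deg`/`‖·‖` multiplicative (G09 `WeilGroup.norm_mul`), are explicit hypotheses (D-0014).
Ref: Tate, Corvallis 1979, (2.2), (3.4.5); Deligne, Antwerp II (1973), §2.3, §8.12. [cite: Corvallis1979, (2.2] -/
def _root_.Literature.NumberTheory.GaloisRepresentations.WeilGroup.normCpow (hmul : GaloisRepresentations.IsFrobPow.mul (F := F))
    (huniq : GaloisRepresentations.IsFrobPow.unique (F := F)) (s : ℂ) : GaloisRepresentations.WeilGroup F →* ℂ where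
  toFun w := ((GaloisRepresentations.WeilGroup.norm w : ℝ) : ℂ) ^ s
  map_one' := by simp [norm_one hmul huniq]
  map_mul' w w' := by
    rw [GaloisRepresentations.WeilGroup.norm_mul hmul huniq, Complex.ofReal_mul]
    exact Complex.mul_cpow_ofReal_nonneg (norm_pos w).le (norm_pos w').le s

/-- Unfolding lemma for `WeilGroup.normCpow`.  Ref: Tate, Corvallis 1979, (2.2). [cite: Corvallis1979, (2.2] -/
@[simp] theorem _root_.Literature.NumberTheory.GaloisRepresentations.WeilGroup.normCpow_apply (hmul : GaloisRepresentations.IsFrobPow.mul (F := F))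
    (huniq : GaloisRepresentations.IsFrobPow.unique (F := F)) (s : ℂ) (w : GaloisRepresentations.WeilGroup F) :
    normCpow hmul huniq s w = ((GaloisRepresentations.WeilGroup.norm w : ℝ) : ℂ) ^ s := rfl

/-- `ω_s` is trivial on inertia.  Ref: Tate, Corvallis 1979, (2.2). [cite: Corvallis1979, (2.2] -/
theorem _root_.Literature.NumberTheory.GaloisRepresentations.WeilGroup.normCpow_eq_one_of_mem_inertia (hmul : GaloisRepresentations.IsFrobPow.mul (F := F))
    (huniq : GaloisRepresentations.IsFrobPow.unique (F := F)) (s : ℂ) {w : GaloisRepresentations.WeilGroup F} (hw : w ∈ inertia F) :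
    normCpow hmul huniq s w = 1 := by
  simp [(norm_eq_one_iff_mem_inertia hmul huniq).mpr hw]

/-- The **unramified twist** `r ⊗ ω_s = (ρ ⊗ ‖·‖^s, N)` of a complex Weil–Deligne
representation: `ρ_s(w) = ‖w‖^s • ρ(w)`, same monodromy.  For a geometric Frobenius `Φ`
(`deg Φ = -1`), `ρ_s(Φ) = q^{-s} ρ(Φ)`.  Hypotheses `hmul huniq` as for `WeilGroup.normCpow`.
Ref: Deligne, Antwerp II (1973), §8.12; Tate, Corvallis 1979, (3.4.5), (4.1.6). [cite: II1973] -/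
def _root_.Literature.NumberTheory.GaloisRepresentations.WeilDeligneRep.unramifiedTwist (hmul : GaloisRepresentations.IsFrobPow.mul (F := F)) (huniq : GaloisRepresentations.IsFrobPow.unique (F := F))
    (r : WeilDeligneRep F ℂ V) (s : ℂ) : WeilDeligneRep F ℂ V where
  ρ :=
    { toFun := fun w => normCpow hmul huniq s w • r.ρ w
      map_one' := by simp only [map_one, one_smul]
      map_mul' := fun w w' => by rw [map_mul, map_mul, smul_mul_smul_comm] }
  isContinuous := by
    obtain ⟨U, hU, hUo, hρ⟩ := r.isContinuous
    refine ⟨U, hU, hUo, fun u hu => ?_⟩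
    simp only [MonoidHom.coe_mk, OneHom.coe_mk, hρ u hu,
      normCpow_eq_one_of_mem_inertia hmul huniq s (hU hu), one_smul]
  N := r.N
  isNilpotent_N := r.isNilpotent_N
  conj_N w := by
    simp only [MonoidHom.coe_mk, OneHom.coe_mk, LinearMap.smul_comp, LinearMap.comp_smul,
      r.conj_N w]
    rw [smul_comm]

/-- Unfolding lemma: `(r.unramifiedTwist s).ρ w = ‖w‖^s • r.ρ w`.
Ref: Tate, Corvallis 1979, (3.4.5). [cite: Corvallis1979, (3.4.5] -/
@[simp] theorem _root_.Literature.NumberTheory.GaloisRepresentations.WeilDeligneRep.unramifiedTwist_ρ_apply (hmul : GaloisRepresentations.IsFrobPow.mul (F := F))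
    (huniq : GaloisRepresentations.IsFrobPow.unique (F := F)) (r : WeilDeligneRep F ℂ V) (s : ℂ) (w : GaloisRepresentations.WeilGroup F) :
    (r.unramifiedTwist hmul huniq s).ρ w = normCpow hmul huniq s w • r.ρ w := rfl

/-- The unramified twist does not change the monodromy.  Ref: Deligne, Antwerp II, §8.12. [folklore] -/
@[simp] theorem _root_.Literature.NumberTheory.GaloisRepresentations.WeilDeligneRep.unramifiedTwist_N (hmul : GaloisRepresentations.IsFrobPow.mul (F := F))
    (huniq : GaloisRepresentations.IsFrobPow.unique (F := F)) (r : WeilDeligneRep F ℂ V) (s : ℂ) :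
    (r.unramifiedTwist hmul huniq s).N = r.N := rfl

/-- **No small subgroups** (named fact, D-0014; thread it as the hypothesis `hns`).  A continuous
character `χ : W_F →ₜ* ℂˣ` is trivial on some open subgroup `U ≤ I_F` of `W_F`: `I_F` is
profinite (open compact subgroups form a neighbourhood basis of `1`) and `ℂˣ` has a
neighbourhood of `1` containing no non-trivial subgroup.
Ref: Tate, Corvallis 1979, (1.4.1), (2.2); Deligne, Antwerp II (1973), §8.3. [cite: Corvallis1979, (1.4.1] -/
def _root_.Literature.NumberTheory.GaloisRepresentations.WeilGroup.exists_subgroup_le_inertia_isOpen_of_continuous : Prop :=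
  ∀ χ : GaloisRepresentations.WeilGroup F →ₜ* ℂˣ,
    ∃ U : Subgroup (GaloisRepresentations.WeilGroup F), U ≤ inertia F ∧ IsOpen (U : Set (GaloisRepresentations.WeilGroup F)) ∧
      ∀ u ∈ U, χ u = 1

/-- The one-dimensional representation of `W_F` on `ℂ` given by a continuous character
`χ : W_F →ₜ* ℂˣ` acting by scalar multiplication (Mathlib `DistribMulAction.toModuleEnd`).
Ref: Tate, Corvallis 1979, (2.2). [cite: Corvallis1979, (2.2] -/
def _root_.Literature.NumberTheory.GaloisRepresentations.WeilGroup.charRep (χ : GaloisRepresentations.WeilGroup F →ₜ* ℂˣ) : Representation ℂ (GaloisRepresentations.WeilGroup F) ℂ :=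
  (DistribMulAction.toModuleEnd ℂ ℂ).comp ((Units.coeHom ℂ).comp χ.toMonoidHom)

/-- Unfolding lemma: `charRep χ w z = χ w * z`.  Ref: Tate, Corvallis 1979, (2.2). [cite: Corvallis1979, (2.2] -/
@[simp] theorem _root_.Literature.NumberTheory.GaloisRepresentations.WeilGroup.charRep_apply (χ : GaloisRepresentations.WeilGroup F →ₜ* ℂˣ) (w : GaloisRepresentations.WeilGroup F)
    (z : ℂ) : charRep χ w z = (χ w : ℂ) * z := rfl

/-- `charRep χ` is continuous in the sense of `WeilGroup.IsContinuousRep`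
(given the named fact `hns : WeilGroup.exists_subgroup_le_inertia_isOpen_of_continuous`).
Ref: Tate, Corvallis 1979, (2.2). [cite: Corvallis1979, (2.2] -/
theorem _root_.Literature.NumberTheory.GaloisRepresentations.WeilGroup.isContinuousRep_charRep
    (hns : exists_subgroup_le_inertia_isOpen_of_continuous (F := F)) (χ : GaloisRepresentations.WeilGroup F →ₜ* ℂˣ) :
    IsContinuousRep (charRep χ) := by
  obtain ⟨U, hU, hUo, hχ⟩ := hns χ
  refine ⟨U, hU, hUo, fun u hu => ?_⟩
  ext
  simp [hχ u hu]

/-- The **Weil–Deligne representation of a quasi-character**: for a local Artin datum `d`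
(G09 `LocalArtinData`) and `χ : Fˣ →ₜ* ℂˣ`, the one-dimensional representation
`(χ ∘ artin, N = 0)` on `ℂ` (`d.recGL1 χ`, local Langlands for `GL₁`).  The continuity witness
is the named fact `hns : WeilGroup.exists_subgroup_le_inertia_isOpen_of_continuous` (D-0014,
explicit hypothesis).
Ref: Tate, Corvallis 1979, (1.4.5), (2.2), (4.1.3); Deligne, Antwerp II (1973), §2.3. [cite: Corvallis1979, (1.4.5] -/
def _root_.Literature.NumberTheory.GaloisRepresentations.WeilDeligneRep.ofQuasiChar (hns : exists_subgroup_le_inertia_isOpen_of_continuous (F := F))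
    (d : GaloisRepresentations.LocalArtinData F) (χ : Automorphic.QuasiChar F) : WeilDeligneRep F ℂ ℂ :=
  ofRep (charRep (d.recGL1 χ)) (isContinuousRep_charRep hns _)

/-- Unfolding lemma: `(ofQuasiChar d χ).ρ w z = χ (artin w) * z`.
Ref: Tate, Corvallis 1979, (1.4.5). [cite: Corvallis1979, (1.4.5] -/
@[simp] theorem _root_.Literature.NumberTheory.GaloisRepresentations.WeilDeligneRep.ofQuasiChar_ρ_apply
    (hns : exists_subgroup_le_inertia_isOpen_of_continuous (F := F)) (d : GaloisRepresentations.LocalArtinData F)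
    (χ : Automorphic.QuasiChar F) (w : GaloisRepresentations.WeilGroup F) (z : ℂ) :
    (ofQuasiChar hns d χ).ρ w z = (χ (d.artin w) : ℂ) * z := rfl

/-- `(ofQuasiChar d χ).N = 0`.  Ref: Tate, Corvallis 1979, (4.1.3). [cite: Corvallis1979, (4.1.3] -/
@[simp] theorem _root_.Literature.NumberTheory.GaloisRepresentations.WeilDeligneRep.ofQuasiChar_N (hns : exists_subgroup_le_inertia_isOpen_of_continuous (F := F))
    (d : GaloisRepresentations.LocalArtinData F) (χ : Automorphic.QuasiChar F) :
    (ofQuasiChar hns d χ).N = 0 := rfl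

/-- **The Frobenius determinant factor** `det(-Φ q^{-s} | V^{I_F} ⧸ (ker N)^{I_F})` of Tate,
Corvallis 1979, (4.1.6) (Deligne, Antwerp II (1973), §8.12, (8.12.1)), computed — following the
pattern of G09 `WeilDeligneRep.eulerFactor` — with the chosen geometric Frobenius
`Φ = WeilDeligneRep.geomFrob F` (`deg Φ = -1`, sign convention of `Literature.Prelude.GalRep.WeilGroup`):
`LinearMap.det (-(q ^ (-s) • Φ|_{V^I ⧸ (ker N)^I}))`.  Two geometric Frobenii differ by an
element of `I_F`, which acts trivially on `V^{I_F}`, so nothing depends on the choice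
(`frobDetFactor_eq`).  If `V^I = (ker N)^I` (e.g. `N = 0`) the factor is `1`
(`frobDetFactor_ofRep`).  Intended for finite-dimensional `V` (Mathlib's `LinearMap.det` is the
junk value `1` otherwise).  Hypotheses (D-0014 threads, as for G09 `eulerFactor`):
`hn : absInertia_normal F` (stability of `V^{I_F}`), `hex : exists_isFrobPow` (the Frobenius
`geomFrob F hex`). [cite: Corvallis1979, (4.1.6] -/
def _root_.Literature.NumberTheory.GaloisRepresentations.WeilDeligneRep.frobDetFactor (r : WeilDeligneRep F ℂ V) (hn : GaloisRepresentations.absInertia_normal F)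
    (hex : GaloisRepresentations.exists_isFrobPow (F := F)) (s : ℂ) : ℂ :=
  LinearMap.det (-(((residueFieldCard F : ℂ) ^ (-s)) • r.inertiaQuotEnd hn (geomFrob F hex)))

/-- **Independence of the Frobenius** (named fact, D-0014): for every geometric Frobenius `Φ`
(`deg Φ = -1`), `frobDetFactor r s = det(-q^{-s} Φ | V^I ⧸ (ker N)^I)` (inertia acts trivially
on `V^{I_F}`).
Ref: Tate, Corvallis 1979, (4.1.6); Deligne, Antwerp II (1973), §8.12. [cite: Corvallis1979, (4.1.6] -/
def _root_.Literature.NumberTheory.GaloisRepresentations.WeilDeligneRep.frobDetFactor_eq : Prop :=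
  ∀ (hn : GaloisRepresentations.absInertia_normal F) (hex : GaloisRepresentations.exists_isFrobPow (F := F)) (r : WeilDeligneRep F ℂ V)
    (s : ℂ) {Φ : GaloisRepresentations.WeilGroup F}, deg Φ = -1 →
    r.frobDetFactor hn hex s =
      LinearMap.det (-(((residueFieldCard F : ℂ) ^ (-s)) • r.inertiaQuotEnd hn Φ))

/-- For trivial monodromy the Frobenius determinant factor is `1` (`V^I ⧸ (ker N)^I = 0`).
Ref: Tate, Corvallis 1979, (4.1.6). [cite: Corvallis1979, (4.1.6] -/
theorem _root_.Literature.NumberTheory.GaloisRepresentations.WeilDeligneRep.frobDetFactor_ofRep (ρ : Representation ℂ (GaloisRepresentations.WeilGroup F) V) (h : IsContinuousRep ρ)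
    (hn : GaloisRepresentations.absInertia_normal F) (hex : GaloisRepresentations.exists_isFrobPow (F := F)) (s : ℂ) :
    (ofRep ρ h).frobDetFactor hn hex s = 1 := by
  haveI : Subsingleton ((ofRep ρ h).inertiaInvariants ⧸ (ofRep ρ h).kerNInertiaInvariants) := by
    rw [Submodule.Quotient.subsingleton_iff, eq_top_iff]
    rintro ⟨v, hv⟩ -
    simp only [kerNInertiaInvariants, Submodule.mem_comap, Submodule.subtype_apply,
      inertiaInvariantsKerN, Submodule.mem_inf, LinearMap.mem_ker, ofRep_N, LinearMap.zero_apply,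
      true_and]
    exact hv
  exact LinearMap.det_eq_one_of_subsingleton _

end Complex

/-! ### Induced representations -/

section Induced

variable {E : Type*} [Field E] [ValuativeRel E] [TopologicalSpace E] [IsNonarchimedeanLocalField E]
  {E' : Type*} [Field E'] [ValuativeRel E'] [TopologicalSpace E'] [IsNonarchimedeanLocalField E']
  [Algebra E E']
  {C : Type*} [Field C] [CharZero C] {V : Type*} [AddCommGroup V] [Module C V]
  {V' : Type*} [AddCommGroup V'] [Module C V']

/-- `r` **is induced from** `r'` along `E'/E`: the representation `ρ` of `W_E` is isomorphic
(Mathlib `Representation.Equiv`) to the induction `Ind_{W_{E'}}^{W_E} ρ'` (Mathlib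
`Representation.ind`, on `Representation.IndV`) along `WeilGroup.map E E' h : W_{E'} →* W_E`.
The inclusion `res(W_{E'}) ≤ W_E` is the explicit hypothesis `h` (supplied for finite `E'/E`
by G09 `WeilGroup.weilSubgroup_map_absGaloisRestrict_le`), so no sorried term enters the type.
Only the `ρ`-parts are compared (`ε₀` only depends on `ρ`, `LocalEpsilonSystem.indep_N`).
Ref: Deligne, Antwerp II (1973), §4.1, (4.1.4); Bushnell–Henniart (2006), §29.4; Tate,
Corvallis 1979, (3.4.1). [cite: II1973] -/
def _root_.Literature.NumberTheory.GaloisRepresentations.WeilDeligneRep.IsInducedFrom (h : (GaloisRepresentations.weilSubgroup E').map (GaloisRepresentations.absGaloisRestrict E E').toMonoidHom ≤ GaloisRepresentations.weilSubgroup E)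
    (r : WeilDeligneRep E C V) (r' : WeilDeligneRep E' C V') : Prop :=
  Nonempty (r.ρ.Equiv (Representation.ind (GaloisRepresentations.WeilGroup.map E E' h) r'.ρ))

end Induced

end WeilDeligneRep

/-! ### Deligne's local constants -/

section Automorphic

/-- A **system of local constants** over the non-archimedean local field `F` (Deligne's
`ε₀ = ε(ρ, ψ, dx)` at `s = 0`, Langlands' `ε(0, ρ, ψ)`), packaged as a hypothesis structure:
for every finite extension `E/F` (given as a type with its own local-field structure), every
additive character `ψ` of `E`, every measure `μ` on `E` and every complex Weil–Deligne
representation `r = (ρ, N)` of `W_E` on a finite-dimensional `V : Type`, a number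
`ε₀ E ψ μ r ∈ ℂ`, together with the local Artin data `artin E` used to normalise it, subject to
Deligne's axioms (all under `ψ` continuous non-trivial and `μ` a Haar measure):
non-vanishing, isomorphism invariance, dependence on `ρ` only, multiplicativity in short exact
sequences, agreement with Tate's `ε(0, χ, ψ)` in dimension one, the scaling rules in `μ` and
`ψ`, and inductivity in degree zero.  Nothing is constructed and nothing is sorried inside the
structure; existence and uniqueness are `nonempty_localEpsilonSystem` and
`localEpsilonSystem_unique`.
Ref: Deligne, Antwerp II, LNM 349 (1973), §4.1, Thm. 4.1, §5, Thm. 6.5, §8.12; Tate, Corvallis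
1979, (3.4.2)–(3.4.7); Bushnell–Henniart (2006), §29.4. [cite: BushnellHenniart2006] -/
structure LocalEpsilonSystem (F : Type) [Field F] [ValuativeRel F] [TopologicalSpace F]
    [IsNonarchimedeanLocalField F] where
  /-- The local Artin data of each finite extension `E/F` against which `ε₀` is normalised
  (`dim_one`, `addChar_shift`).  No norm-compatibility between the data of different `E` is
  required by the structure (the target statements do not need it); the witness of
  `nonempty_localEpsilonSystem` uses the canonical, compatible, Artin maps. -/
  artin : ∀ (E : Type) [Field E] [ValuativeRel E] [TopologicalSpace E]
    [IsNonarchimedeanLocalField E] [Algebra F E] [FiniteDimensional F E], GaloisRepresentations.LocalArtinData E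
  /-- The local constant `ε₀ E ψ μ r = ε(ρ, ψ, μ)`. -/
  ε₀ : ∀ (E : Type) [Field E] [ValuativeRel E] [TopologicalSpace E]
    [IsNonarchimedeanLocalField E] [Algebra F E] [FiniteDimensional F E] [MeasurableSpace E]
    [BorelSpace E] {V : Type} [AddCommGroup V] [Module ℂ V] [FiniteDimensional ℂ V],
    AddChar E Circle → Measure E → GaloisRepresentations.WeilDeligneRep E ℂ V → ℂ
  /-- `ε₀ ≠ 0` (Deligne 1973, Thm. 4.1). -/
  ne_zero : ∀ (E : Type) [Field E] [ValuativeRel E] [TopologicalSpace E]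
    [IsNonarchimedeanLocalField E] [Algebra F E] [FiniteDimensional F E] [MeasurableSpace E]
    [BorelSpace E] {V : Type} [AddCommGroup V] [Module ℂ V] [FiniteDimensional ℂ V]
    (ψ : AddChar E Circle) (μ : Measure E) [μ.IsAddHaarMeasure] (r : GaloisRepresentations.WeilDeligneRep E ℂ V),
    ψ.IsContinuousNontrivial → ε₀ E ψ μ r ≠ 0
  /-- `ε₀` is an isomorphism invariant (Deligne 1973, §4.1). -/
  equiv : ∀ (E : Type) [Field E] [ValuativeRel E] [TopologicalSpace E]
    [IsNonarchimedeanLocalField E] [Algebra F E] [FiniteDimensional F E] [MeasurableSpace E]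
    [BorelSpace E] {V : Type} [AddCommGroup V] [Module ℂ V] [FiniteDimensional ℂ V]
    {V' : Type} [AddCommGroup V'] [Module ℂ V'] [FiniteDimensional ℂ V']
    (ψ : AddChar E Circle) (μ : Measure E) [μ.IsAddHaarMeasure] (r : GaloisRepresentations.WeilDeligneRep E ℂ V)
    (r' : GaloisRepresentations.WeilDeligneRep E ℂ V'),
    ψ.IsContinuousNontrivial → r.IsEquivalent r' → ε₀ E ψ μ r = ε₀ E ψ μ r'
  /-- `ε₀ (ρ, N)` only depends on `ρ` (Deligne 1973, §8.12). -/
  indep_N : ∀ (E : Type) [Field E] [ValuativeRel E] [TopologicalSpace E]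
    [IsNonarchimedeanLocalField E] [Algebra F E] [FiniteDimensional F E] [MeasurableSpace E]
    [BorelSpace E] {V : Type} [AddCommGroup V] [Module ℂ V] [FiniteDimensional ℂ V]
    (ψ : AddChar E Circle) (μ : Measure E) [μ.IsAddHaarMeasure] (r r' : GaloisRepresentations.WeilDeligneRep E ℂ V),
    ψ.IsContinuousNontrivial → r.ρ = r'.ρ → ε₀ E ψ μ r = ε₀ E ψ μ r'
  /-- Multiplicativity in short exact sequences `0 → p → V → V/p → 0`
  (Deligne 1973, Thm. 4.1 (1)). -/
  mul_subrep : ∀ (E : Type) [Field E] [ValuativeRel E] [TopologicalSpace E]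
    [IsNonarchimedeanLocalField E] [Algebra F E] [FiniteDimensional F E] [MeasurableSpace E]
    [BorelSpace E] {V : Type} [AddCommGroup V] [Module ℂ V] [FiniteDimensional ℂ V]
    (ψ : AddChar E Circle) (μ : Measure E) [μ.IsAddHaarMeasure] (r : GaloisRepresentations.WeilDeligneRep E ℂ V)
    (p : Submodule ℂ V) (h : r.IsSubrep p), ψ.IsContinuousNontrivial →
    ε₀ E ψ μ r = ε₀ E ψ μ (r.ofSubrep p h) * ε₀ E ψ μ (r.toQuotient p h)
  /-- Dimension one: `ε₀(χ ∘ artin, ψ, μ) = ε(0, χ, ψ, μ)`, the constant `e` of Tate's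
  `ε(s, χ, ψ) = e q^{-a s}` (`HasTateEpsilon`; the pair `(e, a)` is unique,
  `existsUnique_hasTateEpsilon`, and independent of the Haar measure `μ'` on `Eˣ`); the named
  fact `hns : WeilGroup.exists_subgroup_le_inertia_isOpen_of_continuous` (continuity of
  `χ ∘ artin`, needed to form `WeilDeligneRep.ofQuasiChar`) is a hypothesis of the axiom
  (Deligne 1973, Thm. 4.1 (2), §3; Tate 1979, (3.2), (3.4.2)). -/
  dim_one : ∀ (E : Type) [Field E] [ValuativeRel E] [TopologicalSpace E]
    [IsNonarchimedeanLocalField E] [Algebra F E] [FiniteDimensional F E] [MeasurableSpace E]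
    [BorelSpace E] (hns : GaloisRepresentations.WeilGroup.exists_subgroup_le_inertia_isOpen_of_continuous (F := E))
    (ψ : AddChar E Circle) (μ : Measure E) [μ.IsAddHaarMeasure]
    (χ : QuasiChar E) (μ' : Measure Eˣ) [μ'.IsHaarMeasure] (e : ℂ) (a : ℤ),
    ψ.IsContinuousNontrivial → HasTateEpsilon ψ μ μ' χ e a →
    ε₀ E ψ μ (GaloisRepresentations.WeilDeligneRep.ofQuasiChar hns (artin E) χ) = e
  /-- Dependence on the Haar measure: `ε₀(ρ, ψ, c μ) = c ^ dim V · ε₀(ρ, ψ, μ)` for `c > 0`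
  (Deligne 1973, (5.3); Tate 1979, (3.4.3)). -/
  measure_smul : ∀ (E : Type) [Field E] [ValuativeRel E] [TopologicalSpace E]
    [IsNonarchimedeanLocalField E] [Algebra F E] [FiniteDimensional F E] [MeasurableSpace E]
    [BorelSpace E] {V : Type} [AddCommGroup V] [Module ℂ V] [FiniteDimensional ℂ V]
    (ψ : AddChar E Circle) (μ : Measure E) [μ.IsAddHaarMeasure] (r : GaloisRepresentations.WeilDeligneRep E ℂ V)
    (c : ℝ≥0), ψ.IsContinuousNontrivial → c ≠ 0 →
    ε₀ E ψ (c • μ) r = (c : ℂ) ^ finrank ℂ V * ε₀ E ψ μ r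
  /-- Dependence on the additive character: for `b ∈ Eˣ` and `ψ_b(x) = ψ(b x)`
  (Mathlib `AddChar.mulShift`), `ε₀(ρ, ψ_b, μ) = det ρ(w) · ‖b‖^{-dim V} · ε₀(ρ, ψ, μ)` for any
  `w ∈ W_E` with `artin w = b` (`det ∘ ρ` factors through `artin`)
  (Deligne 1973, (5.4); Tate 1979, (3.2.3), (3.4.4)). -/
  addChar_shift : ∀ (E : Type) [Field E] [ValuativeRel E] [TopologicalSpace E]
    [IsNonarchimedeanLocalField E] [Algebra F E] [FiniteDimensional F E] [MeasurableSpace E]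
    [BorelSpace E] {V : Type} [AddCommGroup V] [Module ℂ V] [FiniteDimensional ℂ V]
    (ψ : AddChar E Circle) (μ : Measure E) [μ.IsAddHaarMeasure] (r : GaloisRepresentations.WeilDeligneRep E ℂ V)
    (b : Eˣ) (w : GaloisRepresentations.WeilGroup E), ψ.IsContinuousNontrivial → (artin E).artin w = b →
    ε₀ E (ψ.mulShift (b : E)) μ r =
      LinearMap.det (r.ρ w) * (((normAbs E (b : E) : ℝ≥0) : ℝ) : ℂ) ^ (-(finrank ℂ V : ℤ)) *
        ε₀ E ψ μ r
  /-- **Inductivity in degree zero** along a finite *separable* extension `E'/E` of finite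
  extensions of `F` (`[Algebra.IsSeparable E E']`, so that `tr_{E'/E}` is surjective and
  `ψ ∘ tr` is again continuous non-trivial; Deligne works inside a separable closure — without
  separability the axiom would be inconsistent in characteristic `p`, e.g. for the Frobenius
  `E → E`, where `tr = 0`; and `[ValuativeExtension E E']`, the valuation of `E'` restricts to
  that of `E`, as in G09 `WeilGroup.weilSubgroup_map_absGaloisRestrict_le`), in division-free
  form: if `ρ ≅ Ind ρ'` and `ρ₁ ≅ Ind 1_{E'}` then
  `ε₀(ρ, ψ, μ) · ε₀(1_{E'}, ψ ∘ tr, μ') ^ dim ρ' = ε₀(ρ', ψ ∘ tr, μ') · ε₀(ρ₁, ψ, μ) ^ dim ρ'`,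
  i.e. `ε₀(Ind ρ') / ε₀(ρ', ψ ∘ tr) = λ(E'/E, ψ) ^ dim ρ'` with
  `λ(E'/E, ψ) = ε₀(Ind 1_{E'}, ψ) / ε₀(1_{E'}, ψ ∘ tr)`; both sides are independent of the
  Haar measures since the virtual representations have degree `0`
  (Deligne 1973, Thm. 4.1 (3), §4.1; Bushnell–Henniart (2006), §29.4; Tate 1979,
  (3.4.6)–(3.4.7)). -/
  induction_degree_zero : ∀ (E : Type) [Field E] [ValuativeRel E] [TopologicalSpace E]
    [IsNonarchimedeanLocalField E] [Algebra F E] [FiniteDimensional F E] [MeasurableSpace E]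
    [BorelSpace E] (E' : Type) [Field E'] [ValuativeRel E'] [TopologicalSpace E']
    [IsNonarchimedeanLocalField E'] [Algebra F E'] [FiniteDimensional F E'] [MeasurableSpace E']
    [BorelSpace E'] [Algebra E E'] [IsScalarTower F E E'] [FiniteDimensional E E']
    [Algebra.IsSeparable E E'] [ValuativeExtension E E']
    (h : (GaloisRepresentations.weilSubgroup E').map (GaloisRepresentations.absGaloisRestrict E E').toMonoidHom ≤ GaloisRepresentations.weilSubgroup E)
    (ψ : AddChar E Circle) (μ : Measure E) [μ.IsAddHaarMeasure] (μ' : Measure E')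
    [μ'.IsAddHaarMeasure]
    {V : Type} [AddCommGroup V] [Module ℂ V] [FiniteDimensional ℂ V]
    {V' : Type} [AddCommGroup V'] [Module ℂ V'] [FiniteDimensional ℂ V']
    {V₁ : Type} [AddCommGroup V₁] [Module ℂ V₁] [FiniteDimensional ℂ V₁]
    (r : GaloisRepresentations.WeilDeligneRep E ℂ V) (r' : GaloisRepresentations.WeilDeligneRep E' ℂ V') (r₁ : GaloisRepresentations.WeilDeligneRep E ℂ V₁),
    ψ.IsContinuousNontrivial → r.IsInducedFrom h r' →
    r₁.IsInducedFrom h (GaloisRepresentations.WeilDeligneRep.trivial ℂ ℂ : GaloisRepresentations.WeilDeligneRep E' ℂ ℂ) →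
    ε₀ E ψ μ r *
        ε₀ E' (ψ.compAddMonoidHom (Algebra.trace E E').toAddMonoidHom) μ'
          (GaloisRepresentations.WeilDeligneRep.trivial ℂ ℂ : GaloisRepresentations.WeilDeligneRep E' ℂ ℂ) ^ finrank ℂ V' =
      ε₀ E' (ψ.compAddMonoidHom (Algebra.trace E E').toAddMonoidHom) μ' r' *
        ε₀ E ψ μ r₁ ^ finrank ℂ V'

/-- **Existence of the local constants** (named fact, D-0014; Deligne 1973, Thm. 4.1,
existence, and Thm. 6.5; Langlands, *On the functional equation of the Artin L-functions*
(unpublished, 1970); Bushnell–Henniart (2006), §29.4 Theorem; Tate, Corvallis 1979, (3.4.1)):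
there is a system of local constants over `F` (the witness is Deligne's system for the canonical
local Artin maps of the finite extensions of `F`). [cite: Deligne1973, Thm. 4.1  existence  and Thm. 6.5] -/
def nonempty_localEpsilonSystem (F : Type) [Field F] [ValuativeRel F] [TopologicalSpace F]
    [IsNonarchimedeanLocalField F] : Prop :=
  Nonempty (LocalEpsilonSystem F)

variable {F : Type} [Field F] [ValuativeRel F] [TopologicalSpace F] [IsNonarchimedeanLocalField F]

/-- **Uniqueness of the local constants** (named fact, D-0014; Deligne 1973, Thm. 4.1,
uniqueness: `ε` is determined by multiplicativity, the dimension-one normalisation and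
inductivity in degree zero, via Brauer induction; Bushnell–Henniart (2006), §29.4; Tate 1979,
(3.4.1)): two systems normalised against the same local Artin data agree on every continuous
non-trivial `ψ`, Haar measure `μ` and Weil–Deligne representation `r`. [cite: Deligne1973, Thm. 4.1  uniqueness:  ε  is determined] -/
def localEpsilonSystem_unique : Prop :=
  ∀ (𝓔 𝓔' : LocalEpsilonSystem F), 𝓔.artin = 𝓔'.artin →
    ∀ (E : Type) [Field E] [ValuativeRel E] [TopologicalSpace E] [IsNonarchimedeanLocalField E]
    [Algebra F E] [FiniteDimensional F E] [MeasurableSpace E] [BorelSpace E]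
    {V : Type} [AddCommGroup V] [Module ℂ V] [FiniteDimensional ℂ V]
    (ψ : AddChar E Circle) (μ : Measure E) [μ.IsAddHaarMeasure] (r : GaloisRepresentations.WeilDeligneRep E ℂ V),
    ψ.IsContinuousNontrivial → 𝓔.ε₀ E ψ μ r = 𝓔'.ε₀ E ψ μ r

variable [MeasurableSpace F] [BorelSpace F]
  {V : Type} [AddCommGroup V] [Module ℂ V] [FiniteDimensional ℂ V]

/-- **The `ε`-factor of a Weil–Deligne representation**:
`ε((ρ, N), s, ψ, μ) := ε₀(ρ ⊗ ω_s, ψ, μ) · det(-Φ q^{-s} | V^{I_F} ⧸ (ker N)^{I_F})`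
(`WeilDeligneRep.unramifiedTwist`, `WeilDeligneRep.frobDetFactor`, the latter with the chosen
geometric Frobenius `WeilDeligneRep.geomFrob F hex`, independent of it by `frobDetFactor_eq`).
The `LocalGaloisGroup` named facts are explicit hypotheses (D-0014, as in G09 `WeilGroup`,
`WeilDeligneRep`): `hmul huniq` (`IsFrobPow.mul/unique`, for `ω_s`), `hn : absInertia_normal F`
and `hex : exists_isFrobPow` (for the determinant factor).
Ref: Deligne, Antwerp II (1973), §8.12, (8.12.1); Tate, Corvallis 1979, (4.1.6). [cite: II1973] -/
def epsilonWD (hmul : GaloisRepresentations.IsFrobPow.mul (F := F)) (huniq : GaloisRepresentations.IsFrobPow.unique (F := F))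
    (hn : GaloisRepresentations.absInertia_normal F) (hex : GaloisRepresentations.exists_isFrobPow (F := F))
    (𝓔 : LocalEpsilonSystem F) (ψ : AddChar F Circle) (μ : Measure F)
    (r : GaloisRepresentations.WeilDeligneRep F ℂ V) (s : ℂ) : ℂ :=
  𝓔.ε₀ F ψ μ (r.unramifiedTwist hmul huniq s) * r.frobDetFactor hn hex s

/-- For trivial monodromy `ε((ρ, 0), s, ψ, μ) = ε₀(ρ ⊗ ω_s, ψ, μ)`.
Ref: Deligne, Antwerp II (1973), §8.12; Tate, Corvallis 1979, (3.4.5), (4.1.6). [cite: II1973] -/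
theorem epsilonWD_ofRep (hmul : GaloisRepresentations.IsFrobPow.mul (F := F)) (huniq : GaloisRepresentations.IsFrobPow.unique (F := F))
    (hn : GaloisRepresentations.absInertia_normal F) (hex : GaloisRepresentations.exists_isFrobPow (F := F))
    (𝓔 : LocalEpsilonSystem F) (ψ : AddChar F Circle) (μ : Measure F)
    (ρ : Representation ℂ (GaloisRepresentations.WeilGroup F) V) (h : IsContinuousRep ρ) (s : ℂ) :
    epsilonWD hmul huniq hn hex 𝓔 ψ μ (GaloisRepresentations.WeilDeligneRep.ofRep ρ h) s =
      𝓔.ε₀ F ψ μ ((GaloisRepresentations.WeilDeligneRep.ofRep ρ h).unramifiedTwist hmul huniq s) := by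
  rw [epsilonWD, GaloisRepresentations.WeilDeligneRep.frobDetFactor_ofRep, mul_one]

/-- **Unramified twists shift `s`** (named fact, D-0014): for any local Artin datum `d` and
`t : ℂ`, `ε((ρ, N) ⊗ (ω_t ∘ artin), s, ψ) = ε((ρ, N), s + t, ψ)`, where `ω_t = |·|_F^t`
(`Automorphic.unramifiedTwist F t`) and `ω_t ∘ artin = ‖·‖^t` on `W_F` for every `d`
(`artin` sends inertia to units and geometric Frobenii to uniformisers).
Ref: Tate, Corvallis 1979, (3.4.5), (4.1.6); Deligne, Antwerp II (1973), (5.5.3), §8.12. [cite: Corvallis1979, (3.4.5] -/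
def epsilonWD_tprod_unramified : Prop :=
  ∀ (hmul : GaloisRepresentations.IsFrobPow.mul (F := F)) (huniq : GaloisRepresentations.IsFrobPow.unique (F := F))
    (hn : GaloisRepresentations.absInertia_normal F) (hex : GaloisRepresentations.exists_isFrobPow (F := F))
    (hns : GaloisRepresentations.WeilGroup.exists_subgroup_le_inertia_isOpen_of_continuous (F := F))
    (𝓔 : LocalEpsilonSystem F) {ψ : AddChar F Circle}, ψ.IsContinuousNontrivial →
    ∀ (μ : Measure F) [μ.IsAddHaarMeasure] (r : GaloisRepresentations.WeilDeligneRep F ℂ V) (d : GaloisRepresentations.LocalArtinData F)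
    (s t : ℂ),
    epsilonWD hmul huniq hn hex 𝓔 ψ μ
        (r.tprod (GaloisRepresentations.WeilDeligneRep.ofQuasiChar hns d (unramifiedTwist F t))) s =
      epsilonWD hmul huniq hn hex 𝓔 ψ μ r (s + t)

end Automorphic

end Literature.NumberTheory.Automorphic
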